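/-
COR-CM (cell pub-hodgecm2, stage 2 of the Hodge ladder) — TRANSPOSITION SURGE, DICTIONARY ITEM (ii) of rfwf v3 §4.2
(COORDINATOR RULING «HODGE RE-POINT» 2026-08-21T12:07:17Z (2)(3); hodge-director/TRANSPOSITION-MAP.md §0 early cut v0–v3:
seat `pub-hodgecm2-tr-typer-2` ↦ item (ii) ↦ this file; prover seat `pub-hodgecm2-tr-prover-2` behind it).
Typer: prover-pub-hodgecm2-tr-typer-2-0, 2026-08-21.  INTERFACE FILE: definitions (data), `Prop`/`Type`-valued structures in
binder style, and small proved projection lemmas; NO axiom, NO `sorry`, nothing of the manuscripts under adjudication is asserted.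
FRAMING (COORDINATOR RULING 2026-08-21T11:55:35Z, binding): `HC_CM` is NOT proved; B01 is a substantive mathematical gap.

ITEM (ii) — manuscript text (rfwf v3 = `run/shared/lean/pub/pub-hodgecm/inputs/2001/summits__hodge-w-rank-four-weil-faces__free__
y1__paper__paper.tex` ll.236–244): «[PerL Lemma 2.1] (reflex): replaced by Lemma l:reflex.  [PerL Def. 2.2, Prop. 2.3] (the space
U_t of holomorphic one-forms of type t and its automorphic dictionary): the definition uses that End⁰(B_t) is a (commutative)
field acting on the isotypic component — here K_i (Lemma l:reflex(b)); the proof uses [Y1neg Lemma 5.1, 5.2, Prop. 5.3,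
Prop. 6.2] (general, by (i)) and [PerL Lemma 2.1(a),(c),(d)] = Lemma l:reflex(a),(c),(d), with H replaced by H′_i … Each type is
treated separately, so the dependence of K_i, H′_i on i is harmless.  [PerL Remark 2.4] (tetrahedron identity, pairwise
distinctness): Lemma l:tetra (inverted and translated by the central φʰ).»  PerL side: PerL v5 (`…pmqp-galois-closure-y1__paper-
v5-d912a121.tex`) Lemma 2.1 ll.125–167, Def. 2.2 ll.169–181, Prop. 2.3 ll.183–206, Remark 2.4 ll.208–213.

TAG (this typer's reading, = stage-1 lead `hodge-director/TRANSPOSITION-STAGE1.md` row (ii) and stage-2 lead TRANSPOSITION-MAP §3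
interface block (ii)): **VERBATIM for (T1)(T2), PARAMETRIC for the automorphic type labels, NO NEW MATHEMATICS** — one-line reason:
the kernel types the face case with ONE type field `K = L = F` (socket header `B01/ThetaRealisationSocket.lean`:62–67; package
`StubTree/Inputs.lean`:97–100), the target spaces `U.Uiso Γ F (f.psi i) ι₁` (`Geometry/Universe.lean`:196) are spanned by pull-backs
from the FULL CM abelian variety `A_{(F, f.psi i)}` with `F` acting through `cmAct` (:92), so rfwf's per-slot fields
`K_i = End⁰(B_i) = F^{H′_i}` (Def. 2.2's «End⁰(B_t) is a field», Lemma l:reflex (b)–(d)) never enter a kernel statement; what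
remains of item (ii) on the `RealisationExistsFace∃` path is (T1)(T2) — tree theorems — and the LABELLING of the automorphic
data feeding `U_Θ` by the INVERSE type `Θ⁻¹` (PerL Prop. 2.3: `U_t = ⊕_{Φ′(π) = Ψ_t} …` with `Ψ_t = φʰ·Φ̃_t⁻¹`; rfwf
`Ψ_i := φʰΘ_i⁻¹` l.222; cell note `HOME/b01/IDEA-2k-anatomy.md` §2 «inverse-type rule»), a parametric rewrite (index set
`Gal(F/ℚ)` through `ι₁`), typed below.

STAGE-1 / TREE DECLARATIONS THIS ITEM GENERALISES OR CONSUMES (file:line; PKG = `run/shared/lean/pub/pub-hodgecm/lean/HodgeCMPerL/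
HodgeCM/`, TREE = `lean/Summits/HodgeConjecture/CorCM/`):
* (T1) pair-sum / tetrahedron identity for the TARGET types `Θ_i = f.psi i`: PKG `HodgeCM.pairSum_psi` `CM/Lemmas.lean`:66 =
  TREE `Summit.HodgeConjecture.CorCM.pairSum_psi` `CM/Lemmas.lean`:72 (PerL form `StubTree.pairSum_of_isPerLTypes` PKG
  `StubTree/Combinatorics.lean`:97) — consumed BY NAME, not restated; transported to the inverse types as field `pairSum` below.
* (T2) pairwise distinctness: PKG `HodgeCM.StubTree.psi_injective` `StubTree/Combinatorics.lean`:31 = TREE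
  `Summit.HodgeConjecture.CorCM.StubTree.psi_injective` `StubTree/Combinatorics.lean`:37 (PerL form `injective_of_isPerLTypes`
  PKG :136) — transported as field `injective` below; rfwf l:tetra's last clause «Θ₁ ≠ Θ₂ differ at some place b ≠ ι₁» (used by
  item (iv), PerL Lemma 3.3 «Ψ₁ ≠ Ψ₂ off ι₁») as field `offPlace`.
* admissibility `ι₁ ∈ Θ_i`: PKG `HodgeCM.admissible_mem_psi` `CM/Lemmas.lean`:85 = TREE `CM/Lemmas.lean`:91 — transported as `mem`.
* Def. 2.2 `U_t`: PKG/TREE `Universe.Uiso` (`Geometry/Universe.lean`:196), `Universe.alphaLine` (:153); Prop. 2.3 / [Y1neg] Thm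
  8.1(a), Prop. 6.2 enter the kernel ONLY as the realisation field `Theta_sub : Theta i Γ ⊆ U.Uiso Γ K (Ψ i) σ` (PKG
  `Automorphic/Realisation.lean`:120; TREE socket `B01/ThetaRealisationSocket.lean`:77) — factored below as
  `Theta ⊆ ofType (Θ⁻¹)` (item (vi)'s half) through `ofType (Θ⁻¹) ≤ Uiso Θ` (item (ii)'s half, field `ofType_le_Uiso`).
* Lemma l:reflex at group level: TREE `Literature.NumberTheory.ComplexMultiplication.typeLift` / `reflexLift` / `IsPrimitive` /
  `reflexField` (`Literature/NumberTheory/ComplexMultiplication/ReflexType.lean`:77/:82/:239/:278, Shimura §8 Props. 25–28),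
  `algValuedIn`, `exists_algHom_comp_eq_of_normal`, `conjGal` (`ReflexCMType.lean`:104/:72, `EmbeddingActionFaithful.lean`:115):
  the inverse type `{g | ι₁ ∘ g⁻¹ ∈ Θ}` used below is Shimura's `S*` = `reflexLift` of the type `algValuedIn ι₁ Θ` with base
  point `id_F` — cited by name, not re-declared (the relation «`Ψ = Θ⁻¹` through `ι₁`» is written inline).

QUANTIFIERS (RE-POINT (1)): item (ii) is V-UNIFORM (pure CM-type combinatorics + a per-`(F, ι₁, V, σ)` labelling of subspaces),
so `Item2` below is stated `∀ σ admissible, ∀ ι₁` at the place of `σ`, `∀ V` — this costs nothing, lets items (iv)/(vi) choose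
`(ι₁, V)`, and serves both the COUPLED day-1 assembly (`σ = ι₁`, p271429) and the ORIENTED variant proposed in
`HOME/b01/IDEA-1j-face-context-dictionary.md` §3 (surface embedding Mathlib-canonical, eigen-embedding admissible).
-/
import Summits.HodgeConjecture.CorCM.CM.Lemmas
import Summits.HodgeConjecture.CorCM.B01.ThetaRealisationSocket
import HarnessLib

/-!
# Transposition item (ii): reflex of the inverted corners, the spaces `U_Θ`, and the tetrahedron identity — typed interface

For a rank-four face `f` of a Galois CM field `F` and an admissible eigen-embedding `σ` (`σ ∈ f.psi i` for all `i`,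
`CM/Lemmas.lean`:91; the filed assembly couples it to the surface embedding, `σ = ι₁`), identify `Hom(F, ℂ)` with
`G = Gal(F/ℚ)` through `g ↦ σ ∘ g` (so `σ ↔ 1`; rfwf §3 «the CM field F is Galois and plays both roles»).  The TARGET types of
the period theorem are `Θ_i := f.psi i` (`CM/Basic.lean`:123; rfwf (eq. theta): the four types containing `1`, whose abelian
varieties `A_{(F,Θ_i)}` receive the morphisms `F_i : P_Γ → A_{(F,Θ_i)}`); the AUTOMORPHIC labels are the inverse types
`Ψ_i := φʰ · Θ_i⁻¹` (rfwf l.222; PerL (eq. Psit), Prop. 2.3), `φʰ ∈ {1, c}` the base point of [Y1neg] Thm 8.1(a).  With base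
point `1`: `σ ∘ g ∈ Ψ_i ↔ σ ∘ g⁻¹ ∈ Θ_i` (the same set results from `σ̄ = σ ∘ c` in place of `σ`, `c` being central with
`c⁻¹ = c`); base point `c` replaces `Ψ_i` by its conjugate type `Ψ̄_i` (`CMTypeOps.bar`).  `Θ_i⁻¹` is in general NOT in the
`G`-orbit of `Θ_i` (cell note `HOME/b01/IDEA-2k-anatomy.md` §2: a translate for `F = ℚ(ζ₇)`, not for non-abelian `G`, first at
degree 8), which is why the label is typed explicitly and NOT as «type-`Θ` data feed `U_Θ`».

Contents:
* `TypeDecomposition U ι₁ V σ` — item (ii)'s DICTIONARY in binder style (surface embedding `ι₁`, eigen-embedding `σ`, as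
  in the socket): subspaces `ofType T Γ ≤ H¹(P_Γ, ℂ)` labelled by CM
  types `T` of `F` (model meaning: the `(1,0)`-classes carried by the automorphic representations `π` of `U(V)` with
  `Φ′(π) = T`, [Y1neg] (eq. Phiprime) / PerL §1.4) with the ONE property the engine consumes, `ofType Θ⁻¹ Γ ≤ U_Θ(Γ)`
  (PerL Prop. 2.3, direction `⊇`); `TypeDecomposition.ofUiso` — its tautological inhabitant (honest vacuity note);
* `Item2Datum U f ι₁ V σ` — THE TYPED AXIOM of item (ii) for one face context: the four labels `Ψ i` (inverse types of
  `f.psi i` through `σ`) with (T1)(T2) transported («inverted and translated»), the off-`σ` difference of `Ψ 0, Ψ 1`, and a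
  `TypeDecomposition`; `Item2 U` (`@[conjecture]`, the displayed obligation) — its closure over all `(F, f, σ, ι₁, V)` with
  `σ` admissible and `ι₁` at the place of `σ` (V-uniform; coupled use `ι₁ = σ`: `Item2.nonempty`); projections
  `Item2Datum.subset_Uiso` (what item (vi) uses to discharge the socket field `Theta_sub`), `.mem`, `.signs`, `.ne`.
What tr-prover-2 proves: `Item2 U` for EVERY universe (inverse types exist and inherit (T1)(T2) — finite Galois
combinatorics over `ReflexType`/`ReflexCMType`; decomposition `ofUiso`), and — the substantive, MODEL-side reading of PerL
Prop. 2.3 — a `TypeDecomposition` on the universe of record whose `ofType T Γ` is the automorphic `T`-part of `H^{1,0}(P_Γ)`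
(Matsushima + [Y1neg] §§4–6 / Rogawski packets), against which item (vi)'s theta one-forms are placed.  Nothing here is a
field of `Universe.FaceThetaDatum`: item (ii) feeds the socket only through `Theta_sub` (stage-2 lead, TRANSPOSITION-MAP §3).
-/

noncomputable section

namespace Summit.HodgeConjecture.CorCM

namespace Transposition

open Literature.AlgebraicGeometry.Motives (CMType)
open NumberField NumberField.ComplexEmbedding

/-! ### §1 The dictionary (PerL Def. 2.2 / Prop. 2.3 transposed) in binder style

Notation used in every docstring below: for `g ∈ Gal(F/ℚ) = (F ≃ₐ[ℚ] F)` the embedding `ι₁ ∘ g : F → ℂ`; a CM type `Ψ` of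
`F` is **the inverse type of `Θ` through `ι₁`** (base point `φʰ = 1`) when `ι₁ ∘ g ∈ Ψ ↔ ι₁ ∘ g⁻¹ ∈ Θ` for all `g` — on the
group this is Shimura's `S* = S⁻¹` (tree `Literature.NumberTheory.ComplexMultiplication.reflexLift` of the type
`algValuedIn ι₁ Θ ⊆ Hom_ℚ(F, F)` with base point `id_F`, `ReflexType.lean`:82, `ReflexCMType.lean`:104); for `F` Galois every
complex embedding is `ι₁ ∘ g` for a unique `g` (`exists_algHom_comp_eq_of_normal`, `ReflexCMType.lean`:72), so each of `Θ, Ψ`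
determines the other.  The relation is written INLINE (no new predicate) so that nothing but the tree's CM-type vocabulary
(`CMType`, `Face.psi`, `PairSum`, `ind`) is declared here. -/

section Dictionary

variable (U : Universe) {F : CMField}

/-- **Item (ii), dictionary half — automorphic type decomposition data** on the Picard modular surfaces `P_Γ = U.pms F ι₁ V Γ`
of `(F, ι₁, V)`, read against the eigen-embedding `σ` (socket generality, `B01/ThetaRealisationSocket.lean`:66: surface
embedding `ι₁` and eigen-embedding `σ` are separate binders; the filed day-1 assembly couples them, `σ = ι₁`): for every CM
type `T` of `F` and level `Γ`, a subspace `ofType T Γ ≤ H¹(P_Γ, ℂ)`.  INTENDED MODEL: the span of the `(1,0)`-classes whose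
automorphic representations `π ⊂ L²([G_U])` (Matsushima; PerL §1.4 `𝒜^{1,0}`) have Hecke character `μ(π)` of CM type
`Φ′(π) = T` ([Y1neg] Lemma 4.1/4.2, PerL (eq. Phiprime)).  The ONE property recorded is the direction of PerL Prop. 2.3
(`U_t = ⊕_{π ∈ 𝒜^{1,0}, Φ′(π) = Ψ_t} m(π) π_f^{K_f} ⊗ line`, proved there from [Y1neg] Lemma 5.1, 5.2, Prop. 5.3, Prop. 6.2 and
PerL Lemma 2.1(a),(c),(d) = rfwf Lemma l:reflex(a),(c),(d)) that the engine consumes through `Theta_sub` (PerL Lemma 3.3(a):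
«the holomorphic 1-forms attached to vectors of `π_i` lie in `U_{tⁱ}`»): classes of automorphic type `Ψ = Θ⁻¹` (inverse type
through `σ`) are `A_{(F,Θ)}`-isotypic `σ`-eigen, i.e. lie in `U_Θ(Γ) = U.Uiso Γ F Θ σ` (`Geometry/Universe.lean`:196).  The
converse inclusion (saturation `U_Θ(Γ) ≤ ofType Θ⁻¹ Γ`, the `⊆` half of Prop. 2.3) holds in the model but is not consumed
on the `FaceThetaDataExists` path, so it is not a field (same policy as the package's `ThetaRealisation`,
`Automorphic/Realisation.lean`:95–99).  Which of `Θ⁻¹`, `\overline{Θ⁻¹}` is the holomorphic label (base point `φʰ ∈ {1, c}`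
of [Y1neg] Thm 8.1(a)) is a convention of the model instance and is absorbed in its `ofType`.  DATA, asserted by no one;
inhabited tautologically over every universe (`TypeDecomposition.ofUiso`) — the mathematical content of Prop. 2.3 is a NAMED
MODEL INSTANCE (tr-prover-2 / model seats), not the existence of an instance. [folklore] -/
structure TypeDecomposition (ι₁ : F →+* ℂ) (V : HermSpace3 F ι₁) (σ : F →+* ℂ) where
  /-- the degree-one classes of `P_Γ` of automorphic type `T` -/
  ofType : CMType F → ∀ Γ : Level V, Submodule ℂ (U.CohC (U.pms F ι₁ V Γ) 1)
  /-- PerL Prop. 2.3 (`⊇`) transposed: classes of automorphic type `Θ⁻¹` (through `σ`) lie in `U_Θ` -/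
  ofType_le_Uiso : ∀ (Θ Ψ : CMType F),
    (∀ g : F ≃ₐ[ℚ] F, σ.comp (g : F →+* F) ∈ Ψ.1 ↔ σ.comp (g.symm : F →+* F) ∈ Θ.1) →
      ∀ Γ : Level V, ofType Ψ Γ ≤ U.Uiso Γ F Θ σ

variable {U}

/-- **Vacuity note made precise**: over every universe the decomposition `T ↦ ⨅ {U_Θ(Γ) | T = Θ⁻¹ through σ}` satisfies the
recorded property — so `TypeDecomposition` carries no existence content by itself; only a named model instance does. [folklore] -/
def TypeDecomposition.ofUiso (ι₁ : F →+* ℂ) (V : HermSpace3 F ι₁) (σ : F →+* ℂ) : TypeDecomposition U ι₁ V σ where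
  ofType T Γ := ⨅ (Θ : CMType F)
    (_ : ∀ g : F ≃ₐ[ℚ] F, σ.comp (g : F →+* F) ∈ T.1 ↔ σ.comp (g.symm : F →+* F) ∈ Θ.1), U.Uiso Γ F Θ σ
  ofType_le_Uiso Θ _ h _ := iInf₂_le Θ h

/-- Projection in the shape of the socket field `Universe.FaceThetaDatum.Theta_sub` (`B01/ThetaRealisationSocket.lean`:77): a SET
of one-forms placed inside `ofType Ψ Γ`, `Ψ = Θ⁻¹`, lies in `U_Θ(Γ)`. [folklore] -/
theorem TypeDecomposition.subset_Uiso {ι₁ : F →+* ℂ} {V : HermSpace3 F ι₁} {σ : F →+* ℂ} (D : TypeDecomposition U ι₁ V σ)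
    {Θ Ψ : CMType F} (h : ∀ g : F ≃ₐ[ℚ] F, σ.comp (g : F →+* F) ∈ Ψ.1 ↔ σ.comp (g.symm : F →+* F) ∈ Θ.1)
    {Γ : Level V} {S : Set (U.CohC (U.pms F ι₁ V Γ) 1)} (hS : S ⊆ D.ofType Ψ Γ) : S ⊆ U.Uiso Γ F Θ σ :=
  fun _ hω => D.ofType_le_Uiso Θ Ψ h Γ (hS hω)

end Dictionary

/-! ### §2 The typed axiom of item (ii) for one face context, and its closure `Item2` -/

section Item

variable (U : Universe) {F : CMField}

/-- **ITEM (ii) OF rfwf §4.2 FOR ONE FACE CONTEXT** `(F, f, ι₁, V, σ)` — surface field `F` with surface embedding `ι₁` and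
`V : HermSpace3 F ι₁`, face `f`, eigen-embedding `σ` (admissible; the filed assembly takes `σ = ι₁`) — everything items
(iv)–(vi) use of «reflex ∕ `U_t` ∕ tetrahedron», in the quantifier shape PerL delivers.  TARGET types `Θ_i := f.psi i`
(`CM/Basic.lean`:123); fields:
* `Ψ i` — the four AUTOMORPHIC TYPE LABELS and `isInverse` — `Ψ i` is the inverse type of `f.psi i` through `σ`: `σ ∘ g ∈ Ψ i
  ↔ σ ∘ g⁻¹ ∈ f.psi i` for all `g ∈ Gal(F/ℚ)` (rfwf `Ψ_i = φʰΘ_i⁻¹` l.222 with `φʰ = 1`; PerL (eq. Psit); the same set results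
  from `σ̄ = σ ∘ c` in place of `σ`, `c` being central; for the base point `c` read `bar (Ψ i)`); existence of such CM types =
  rfwf Lemma l:reflex (a) / PerL Lemma 2.1(a) «`Ψ_t` is a CM type of `L`»; BRIDGE TO ITEM (iv): with the intended sign-recipe
  map `κ(σ ∘ g) = σ ∘ g⁻¹` (PKG `ThetaModel.kappa`, `Automorphic/ThetaModel.lean`:92, «PerL (eq:Psit) + Lemma 3.3(a)»; tree
  `Transposition.SignRecipe` of `Item4SignsPlane.lean`, p272401) one has `τ ∈ Ψ i ↔ κ τ ∈ f.psi i`, i.e. item (iv)'s forced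
  signs `reqPos … (f.psi i) τ` ARE the signs of the label `Ψ i` at `τ` — the two items index the same archimedean data;
* `pairSum` — (T1) «inverted and translated» (rfwf l.243): `1_{Ψ₀} + 1_{Ψ₁} = 1_{Ψ₂} + 1_{Ψ₃}` on `Hom(F, ℂ)` = PerL Remark 2.4,
  from `pairSum_psi` (`CM/Lemmas.lean`:72) along `g ↦ g⁻¹` — consumed by item (iv) (PerL Def. 3.2: `μ_W` of infinity type
  `−1_{Ψ₁} − 1_{Ψ₂} = −1_{Ψ₃} − 1_{Ψ₄}`; Lemma 3.3(b) equal signatures of `W₁ ⊕ W₂`, `W₃ ⊕ W₄`, cf. `lemma33b_signs`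
  `CM/Lemmas.lean`:115) and item (v) (the archimedean characters `w = (e_b(Ψ₁), e_b(Ψ₂))_b`, `w′`, rfwf l.259);
* `injective` — (T2) transported (from `StubTree.psi_injective`, TREE `StubTree/Combinatorics.lean`:37; PerL Remark 2.4 «the four
  `Ψ_i` are pairwise distinct»);
* `offPlace` — rfwf Lemma l:tetra, last clause, transported: `Ψ 0`, `Ψ 1` differ at an embedding OFF the place of `σ` (for
  `Θ = f.psi`: `Θ₀ = Φ`, `Θ₁ = Φ^{(ππ′)}` differ exactly over `π, π′`, and `σ` is off `π, π′` by admissibility; inversion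
  preserves «off the place of `σ`» since `{1, c}⁻¹ = {1, c}`) — consumed by item (iv) (PerL Lemma 3.3(b): «`Σ₁₂ ≠ ∅` because
  `Ψ₁ ≠ Ψ₂` and both contain `φʰ`»);
* `dec` — the dictionary (`TypeDecomposition U ι₁ V σ`), through which item (vi) discharges `Theta_sub` (`Item2Datum.subset_Uiso`).
`pairSum`/`injective`/`offPlace` are DERIVABLE from `isInverse` for `F` Galois (finite Galois bookkeeping); they are fields so that
consumers project them without a Galois argument, and tr-prover-2 discharges them once.  `σ ∈ Ψ i` is the derived
`Item2Datum.mem`.  A `Type` (it carries subspaces), asserted by no one. [folklore] -/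
structure Item2Datum (f : Face F) (ι₁ : F →+* ℂ) (V : HermSpace3 F ι₁) (σ : F →+* ℂ) where
  /-- the automorphic type labels `Ψ_i = Θ_i⁻¹` -/
  Ψ : Fin 4 → CMType F
  /-- `Ψ i` is the inverse type of the target type `f.psi i` through `σ`: `σ ∘ g ∈ Ψ i ↔ σ ∘ g⁻¹ ∈ f.psi i` -/
  isInverse : ∀ (i : Fin 4) (g : F ≃ₐ[ℚ] F),
    σ.comp (g : F →+* F) ∈ (Ψ i).1 ↔ σ.comp (g.symm : F →+* F) ∈ (f.psi i).1
  /-- (T1) for the labels -/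
  pairSum : PairSum Ψ
  /-- (T2) for the labels -/
  injective : Function.Injective Ψ
  /-- `Ψ 0`, `Ψ 1` differ off the place of `σ` -/
  offPlace : ∃ τ : F →+* ℂ, InfinitePlace.mk τ ≠ InfinitePlace.mk σ ∧ (τ ∈ (Ψ 0).1 ↔ τ ∉ (Ψ 1).1)
  /-- the dictionary -/
  dec : TypeDecomposition U ι₁ V σ

/-- **`Item2 U`** — item (ii) for every Galois CM field of degree `≥ 6`, every rank-four face `f`, EVERY admissible
eigen-embedding `σ`, EVERY surface embedding `ι₁` at the place of `σ` (`ι₁ ∈ {σ, σ̄}`: the coupled assembly takes `ι₁ = σ`;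
the oriented variant of `HOME/b01/IDEA-1j-face-context-dictionary.md` §3 takes `ι₁` Mathlib-canonical) and EVERY hermitian
3-space `V` (a V-uniform item: the `∀` costs nothing, RE-POINT (1), and leaves the choice of `(ι₁, V)` to items (iv)/(vi)).
This is the hypothesis the day-1 assembly `Item1 → … → Item6 → FaceThetaDataExists` (`Transposition/Assembly.lean` p271429,
stage-2 lead gen 6) takes for item (ii), at `ι₁ = σ`.  EXPECTED PROVABLE for every universe (tr-prover-2: inverse types
exist — Lemma l:reflex (a) — and inherit (T1)/(T2)/`offPlace`; `dec := TypeDecomposition.ofUiso`), so no shadow-falsity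
companion applies; its substantive model-side reading is a NAMED `TypeDecomposition` on the universe of record (PerL Prop. 2.3).
Displayed obligation, asserted by no one. [folklore] -/
@[conjecture]
def Item2 : Prop :=
  ∀ (F : CMField), IsGalois ℚ F → 6 ≤ Module.finrank ℚ F →
    ∀ (f : Face F) (σ : F →+* ℂ), f.Admissible σ →
    ∀ (ι₁ : F →+* ℂ), InfinitePlace.mk ι₁ = InfinitePlace.mk σ →
    ∀ (V : HermSpace3 F ι₁), Nonempty (Item2Datum U f ι₁ V σ)

variable {U}

namespace Item2Datum

variable {f : Face F} {ι₁ : F →+* ℂ} {V : HermSpace3 F ι₁} {σ : F →+* ℂ} (D : Item2Datum U f ι₁ V σ)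

/-- **The projection item (vi) consumes**: one-forms of automorphic type `Ψ i` at level `Γ` lie in `U_{Θ_i}(Γ) =
U.Uiso Γ F (f.psi i) σ` — i.e. `Theta i Γ ⊆ D.dec.ofType (D.Ψ i) Γ` discharges the socket field `Theta_sub i Γ`. [folklore] -/
theorem subset_Uiso (i : Fin 4) {Γ : Level V} {S : Set (U.CohC (U.pms F ι₁ V Γ) 1)}
    (hS : S ⊆ D.dec.ofType (D.Ψ i) Γ) : S ⊆ U.Uiso Γ F (f.psi i) σ :=
  D.dec.subset_Uiso (D.isInverse i) hS

/-- `ofType (Ψ i) Γ ≤ U_{Θ_i}(Γ)` as submodules. [folklore] -/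
theorem ofType_le_Uiso (i : Fin 4) (Γ : Level V) : D.dec.ofType (D.Ψ i) Γ ≤ U.Uiso Γ F (f.psi i) σ :=
  D.dec.ofType_le_Uiso (f.psi i) (D.Ψ i) (D.isInverse i) Γ

/-- The relation is symmetric: `f.psi i` is the inverse type of `Ψ i` (`(Θ⁻¹)⁻¹ = Θ`). [folklore] -/
theorem isInverse_symm (i : Fin 4) (g : F ≃ₐ[ℚ] F) :
    σ.comp (g : F →+* F) ∈ (f.psi i).1 ↔ σ.comp (g.symm : F →+* F) ∈ (D.Ψ i).1 := by
  simpa using (D.isInverse i g.symm).symm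

/-- At the base point: `σ ∈ Ψ i ↔ σ ∈ f.psi i` (`1⁻¹ = 1`). [folklore] -/
theorem self_mem_iff (i : Fin 4) : σ ∈ (D.Ψ i).1 ↔ σ ∈ (f.psi i).1 := by
  have h1 := D.isInverse i 1
  have e : σ.comp ((1 : F ≃ₐ[ℚ] F) : F →+* F) = σ := RingHom.ext fun _ => rfl
  have e' : σ.comp ((1 : F ≃ₐ[ℚ] F).symm : F →+* F) = σ := RingHom.ext fun _ => rfl
  rwa [e, e'] at h1

/-- **The labels contain the base point**: `σ ∈ Ψ i` for admissible `σ` (from `admissible_mem_psi`, `CM/Lemmas.lean`:91) —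
[Y1neg] Thm 8.1(a) «`Φ′(π) ∋ φʰ`», the holomorphy criterion in PerL Prop. 2.3's proof; PerL Lemma 3.3(b) «both contain `φʰ`».
[folklore] -/
theorem mem (hσ : f.Admissible σ) (i : Fin 4) : σ ∈ (D.Ψ i).1 :=
  (D.self_mem_iff i).mpr (admissible_mem_psi f σ hσ i)

/-- Equality of local sign multisets for the LABELS at every embedding (PerL Lemma 3.3(b), sign half, for the inverse types:
the tree's `lemma33b_signs` applied to `D.pairSum`) — the form item (iv) reads. [folklore] -/
theorem signs (ρ : F →+* ℂ) :
    ({ind (D.Ψ 0) ρ, ind (D.Ψ 1) ρ} : Multiset ℤ) = {ind (D.Ψ 2) ρ, ind (D.Ψ 3) ρ} :=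
  lemma33b_signs D.Ψ D.pairSum ρ

/-- The labels are pairwise distinct. [folklore] -/
theorem ne {i j : Fin 4} (h : i ≠ j) : D.Ψ i ≠ D.Ψ j := fun e => h (D.injective e)

end Item2Datum

/-- `Item2` at a COUPLED face context `σ = ι₁` (the filed assembly's shape), unpacked. [folklore] -/
theorem Item2.nonempty (h : Item2 U) {F : CMField} (hG : IsGalois ℚ F) (h6 : 6 ≤ Module.finrank ℚ F) (f : Face F)
    {ι₁ : F →+* ℂ} (hι : f.Admissible ι₁) (V : HermSpace3 F ι₁) : Nonempty (Item2Datum U f ι₁ V ι₁) :=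
  h F hG h6 f ι₁ hι ι₁ rfl V

/-- `Item2` at an ORIENTED face context (surface embedding `ι₁` at the place of the admissible `σ`), unpacked. [folklore] -/
theorem Item2.nonempty_of_mk_eq (h : Item2 U) {F : CMField} (hG : IsGalois ℚ F) (h6 : 6 ≤ Module.finrank ℚ F) (f : Face F)
    {σ : F →+* ℂ} (hσ : f.Admissible σ) {ι₁ : F →+* ℂ} (hι : InfinitePlace.mk ι₁ = InfinitePlace.mk σ)
    (V : HermSpace3 F ι₁) : Nonempty (Item2Datum U f ι₁ V σ) :=
  h F hG h6 f σ hσ ι₁ hι V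

end Item

end Transposition

end Summit.HodgeConjecture.CorCM

end
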